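import Summits.Parity.GeneralizedHardyLittlewood.Theses.FordMaynardSieveConst01651
import Summits.Parity.GeneralizedHardyLittlewood.Theorems.FordMaynardSieveConst01651SieveConst01651ConeKernel
import Summits.Parity.GeneralizedHardyLittlewood.Theorems.FordMaynardSieveConst01651SieveConst01651FiveGeneric
import Summits.Parity.GeneralizedHardyLittlewood.Theorems.FordMaynardSieveConst01651SieveConst01651StubSignClauseFive
import Summits.Parity.GeneralizedHardyLittlewood.Theorems.FordMaynardSieveConst01651SieveConst01651StubCertValuePos
import HarnessLib

/-!
# Route `FordMaynardSieveConst01651` — crux item `GCert01651R` (stmt-Parity-27432), BY NAME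

`GCert01651R` (the repaired certificate crux of the route, rank 2): there is a SYMMETRIC vector function `g`,
piecewise constant on convex polytopes of the ordered cone, with `g(∅) = 1`, supported (apart from `∅`) on vectors
with all `xᵢ > 0.1651` and `Σ xᵢ ≤ 1/2` (the printed CLOSED support clause, Ford–Maynard (7.1)), with
`(𝟙⋆g)(x) ≤ 0` for every `k ≥ 2` and every `x` with `Σ xᵢ = 1`, all `xᵢ ∈ (0.1651, 0.8349)`, and
`V(0.1651, g) = sieveBoundG1 (1651/10000) g > 0`.

Proof (composition of tree theorems — the transport lemmas of the registered skeleton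
`Cruxes/SieveConst01651/Lines/sieve_decomposition.lean` v21, sha16 `ada6d0765119a11e`, l.1300–1421, are already
LANDED in lambda form by the hands: `…SieveConst01651KernelForm.starSum_perm'` (lineage `fordmaynardsieveco-1`),
`…SieveConst01651ConeKernel.{isSymmetric_symmExt', isPiecewiseConstOnCone_symmExt', support_symmExt',
starSum_symmExt_of_monotone', sieveBoundG1_symmExt'}`; this file adds only the dimension bound, the all-`k` sign clause
and the composition):
* the CONE-DATA certificate `g₀` with the five cone-side properties is
  `…SieveConst01651FiveGeneric.stub_coneCertClosed_of_generic_five stub_signClauseFive stub_certValuePos`, both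
  arguments LANDED stubs of the skeleton (`…StubSignClauseFive`, p834287; `…StubCertValuePos`, p837763);
* the witness is its symmetrisation by sorting, `g k x = g₀ k (x ∘ Tuple.sort x)`: symmetric
  (`Tuple.comp_perm_comp_sort_eq_comp_sort`), equal to `g₀` on monotone vectors (`Tuple.sort_eq_refl_iff_monotone`),
  hence piecewise constant on the cone with the same pieces, with the same `(𝟙⋆·)` on monotone vectors and the same
  `sieveBoundG1` (whose integrand lives on monotone vectors); the support clause transports through
  `Tuple.monotone_sort`; the sign clause for ALL `k ≥ 2` and all (not necessarily monotone) `x` follows from the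
  cone clause for `2 ≤ k ≤ 6` by permutation invariance of `(𝟙⋆g)` for symmetric `g` and `k ≤ 6`
  (seven coordinates `> 0.1651` cannot sum to `1`).

Def-free; standard axioms only; no `native_decide`.  Zero summit credit: `ν = 0.1651` is programme currency
below Ford–Maynard's printed `0.1663` (Theorem 2.7 (b)); the summit `Parity` (Bateman–Horn ∧ GHL) is untouched.

References: [FordMaynard2024PrimeSieves] K. Ford, J. Maynard, *On the theory of prime producing sieves*,
arXiv:2407.14368, Definition 7.1, Theorem 7.3 (a), Lemma 8.4, §8.2.
-/

noncomputable section

open Finset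
open Literature.NumberTheory.Sieve Literature.NumberTheory.Sieve.FordMaynard
open Summit.Parity.GeneralizedHardyLittlewood.FordMaynardSieveConst01651SieveConst01651
  (coneCert stub_signClauseFive stub_certValuePos stub_coneCertClosed_of_generic_five)

namespace Summit.Parity.GeneralizedHardyLittlewood.FordMaynardSieveConst01651GCert01651R

open Summit.Parity.GeneralizedHardyLittlewood.FordMaynardSieveConst01651SieveConst01651
  (starSum_perm' isSymmetric_symmExt' starSum_symmExt_of_monotone')

/-- Seven coordinates `> 0.1651` cannot sum to `1`: the sign clause is empty above dimension `6`.
[cite: FordMaynard2024PrimeSieves, Lemma 8.4] -/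
theorem dim_le_six {k : ℕ} {x : Fin k → ℝ} (hbox : ∀ i, (1651 / 10000 : ℝ) < x i)
    (hsum : ∑ i, x i = 1) : k ≤ 6 := by
  by_contra hk
  have hk7 : 7 ≤ k := by omega
  have hlt : ∑ _i : Fin k, (1651 / 10000 : ℝ) < ∑ i, x i := by
    haveI : Nonempty (Fin k) := ⟨⟨0, by omega⟩⟩
    exact Finset.sum_lt_sum_of_nonempty Finset.univ_nonempty fun i _ => hbox i
  rw [Finset.sum_const, Finset.card_univ, Fintype.card_fin, nsmul_eq_mul, hsum] at hlt
  have : (7 : ℝ) ≤ k := by exact_mod_cast hk7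
  nlinarith

/-- The sign clause `(𝟙⋆g) ≤ 0` on `ℋ(1/2, 0, ν₀)` for ALL `k ≥ 2` and all `x`, from the cone clause for
`2 ≤ k ≤ 6` on monotone `x`. [cite: FordMaynard2024PrimeSieves, Theorem 7.3 (a), Lemma 8.4] -/
theorem symm_starSum_nonpos {g₀ : VecFn}
    (hH : ∀ k : ℕ, 2 ≤ k → k ≤ 6 → ∀ x : Fin k → ℝ, Monotone x →
      (∀ i, (1651 / 10000 : ℝ) < x i ∧ x i < 1 - 1651 / 10000) → ∑ i, x i = 1 →
        starSum g₀ k x ≤ 0) :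
    ∀ k : ℕ, 2 ≤ k → ∀ x : Fin k → ℝ,
      (∀ i, (1651 / 10000 : ℝ) < x i ∧ x i < 1 - 1651 / 10000) → ∑ i, x i = 1 →
        starSum (fun k x => g₀ k (x ∘ ⇑(Tuple.sort x))) k x ≤ 0 := by
  intro k hk x hbox hsum
  have hk6 : k ≤ 6 := dim_le_six (fun i => (hbox i).1) hsum
  rw [← starSum_perm' (isSymmetric_symmExt' g₀) k (Tuple.sort x) x,
    starSum_symmExt_of_monotone' g₀ (Tuple.monotone_sort x)]
  refine hH k hk hk6 _ (Tuple.monotone_sort x) (fun i => hbox _) ?_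
  have : (∑ i, (x ∘ ⇑(Tuple.sort x)) i) = ∑ i, x i := by
    simp only [Function.comp_apply]
    exact Equiv.sum_comp (Tuple.sort x) x
  rw [this, hsum]

end Summit.Parity.GeneralizedHardyLittlewood.FordMaynardSieveConst01651GCert01651R

namespace Summit.Parity.GeneralizedHardyLittlewood.Theses.FordMaynardSieveConst01651

open Summit.Parity.GeneralizedHardyLittlewood.FordMaynardSieveConst01651GCert01651R (symm_starSum_nonpos)
open Summit.Parity.GeneralizedHardyLittlewood.FordMaynardSieveConst01651SieveConst01651
  (isSymmetric_symmExt' isPiecewiseConstOnCone_symmExt' support_symmExt' sieveBoundG1_symmExt')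

/-- **The crux `GCert01651R` (stmt-Parity-27432) of route `FordMaynardSieveConst01651`, by name.**  Witness:
the sorting-symmetrisation of the cone-data certificate `g₀` delivered by
`stub_coneCertClosed_of_generic_five stub_signClauseFive stub_certValuePos` (the two LANDED stubs of the
registered skeleton v21).  [cite: FordMaynard2024PrimeSieves, Theorem 7.3 (a), §8.2] -/
theorem gCert01651R_proof : GCert01651R := by
  obtain ⟨g₀, hpc, h00, hsupp, hH, hV⟩ :=
    stub_coneCertClosed_of_generic_five stub_signClauseFive stub_certValuePos
  refine ⟨fun k x => g₀ k (x ∘ ⇑(Tuple.sort x)), isSymmetric_symmExt' g₀,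
    isPiecewiseConstOnCone_symmExt' hpc, fun e => h00 _, support_symmExt' hsupp, symm_starSum_nonpos hH, ?_⟩
  rw [sieveBoundG1_symmExt']
  exact hV

end Summit.Parity.GeneralizedHardyLittlewood.Theses.FordMaynardSieveConst01651

end
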